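import Summits.QuantumFields.QCD.Theses.NestedDissectionSea
import Literature.MathematicalPhysics.QuantumFieldTheory.QCDPhaseQuenched
import Literature.MathematicalPhysics.QuantumFieldTheory.WilsonFlow
import Summits.QuantumFields.QCD.Theorems.NegativeCellsDilute.Negative.CellPositivity
import Summits.QuantumFields.QCD.Theorems.NegativeCellsDilute.Negative.PinWindow
import Summits.QuantumFields.QCD.Theorems.NestedDissectionSeaSignDefectForcesCrossing

/-!
# Line `price-the-seed-not-the-spot` — crux `NestedDissectionSea.NegativeCellsDilute` (stmt-QuantumFields-13900)

Checked skeleton (crux-plan, round 1) of the idea card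
`Cruxes/NegativeCellsDilute/Ideas/price-the-seed-not-the-spot.md` (triage r1-1/2/3: pass), for the
tier-deciding crux of route `route-QuantumFields-NestedDissectionSea`.  Companion line card:
`Lines/price-the-seed-not-the-spot.md`.

## The line in one paragraph

Clause (a) (windowed local dilution of sign defects) is bounded by CONDITIONING ON A LOCATED CARRIER.
A sign defect of a window box forces a real-eigenvalue crossing of the parent or a child Dirichlet cell at a
bare mass `μ' ≥` the valence mass (route support `SignDefectForcesCrossing`, a named hypothesis of the
composition).  Crossing configurations are split by ONE canonical, measurable question about the gauge field:
does the box contain a SEED — a sub-box of scale `ρ` (sides in `[ρ/2, ρ]`) carrying a `(2η₀/ρ)`-approximate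
kernel vector of the naive (anti-Hermitian) part `C − Cᴴ` of the massless Dirichlet Wilson cell of the
WILSON-FLOWED field `wilsonFlow (ρ²/8) U` (tree; the flow at the seed's own scale is the dressing — raw Dirac
balance is swamped by UV noise, cf. TRIAGE r1-1/2 sharpen 1, and a flowed dislocation either dies or becomes an
instanton, i.e. a seed)?  The dichotomy seed / no-seed is a tautology, so no trichotomy stub is needed; the
union bound only consumes MEASURABLE SUPERSETS supplied by the two channel stubs.
* SEEDED crossings (`stub_seededChannel`, T) are priced in PHYSICAL units: a seed costs flowed Wilson action
  `≥ A₀ > 16π²/9` (`stub_seedActionFloor`, S′, the deterministic ZERO-MODE ACTION FLOOR all three triagers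
  asked to see first, with its constant: `16π²/9 = 1/b₀` at `N_f = 3` is exactly the UV-convergence
  threshold `f·b > 4` of the seed count; Bogomolny gives `4π²` for `|Q_loc| = 1`), so the expected number of
  seeds in a box of side `s` is `≲ (s a_k)^θ`, `θ > 0`, UNIFORMLY in `k` (the window's site entropy is the
  Jacobian between per-site and per-physical-volume densities and cancels), and a seed crosses ABOVE the valence
  mass only through a conditional deviation of probability `η_T(k) → 0` (first-order chiral response, route
  L3–L4).
* SEEDLESS crossings (`stub_seedlessChannel`, N — hardest) are cold-island / hot-region large deviations of
  the dressed cell (Dirac balance ⇒ dressed-mass deficit `≥ c_w(η₀)/ρ` on the support of the mode; KineticEdge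
  ⇒ `ρ ≥ ρ_min(k) ≍ |m_c(k)|^{-1/2} → ∞`), of probability `O(a_k^∞)` per lattice position — rate super-linear
  in `β_k` against the linear window entropy `β_k/b₀`.
* THE LINE IS LOCATED ONCE (`stub_sharpCriticalLine`, C, which constructs `reg`): a regularisation with
  `mcrit k → 0` around which the smallest singular value of the WHOLE-TORUS Wilson–Dirac matrix is V-SHAPED to
  precision `a_k/Z_m(k)` on physical tori in the p-regime — it grows linearly as the probe mass moves up from
  `mcrit + a_k M/Z_m` (GAP-UP) and as it moves down from `mcrit − a_k M/Z_m` (GAP-DOWN), with probability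
  `≥ 7/8`.  GAP-UP is the locator the channel stubs consume: if the dressed critical mass sat above
  `mcrit + a_k M₀/Z_m`, typical (topologically trivial, gapped) configurations would show a DECREASING gap
  between two probes below it — a dressed-operator/CLT contradiction, no topology needed.  GAP-UP ∧ GAP-DOWN is
  what the parity stub consumes.  (A crossing-count or parity locator would not do: whole-torus operators of
  `Q = 0` configurations have no real eigenvalue near the line, so exploiting such a locator from below needs a
  LOWER bound on topological activity — the pin's own hardness.)
* THE PIN (b) (`stub_parityPinOnLine`, B — the (b)-partner every triager demanded): on a line located by
  GAP-UP ∧ GAP-DOWN, a distance `M` below it the torus determinant is negative with probability `≥ 1/4` on every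
  odd torus of physical side `≥ R` (parity mixing of the crossed index modes; `Disproof.withoutPin_holds` shows
  this clause is the crux's only junk-proof content, so the line carries it as a registered obligation on the
  SAME `reg`).

`NegativeCellsDilute_of` is the sorry-free composition: `reg`, `M₀` from C; (b) verbatim from B; (a) from T and
N by a two-set union bound for the phase-quenched ratio (`ratio_union_bound`, proved here; integrability of the
`|det|` weight from the tree's `integrable_norm_det_diracMatrix`) and the window sum
`Σ_{j<J} C (2·2^{j+2} a_k)^θ η_T(k) + J(k) η_N(k) ≤ ε` eventually (`window_sum_bound`, proved here: geometric in
`j` — this is where "seeds carry no window entropy" is cashed — and `J(k) ≤ ℓ/a_k + 1` against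
`η_N(k)/a_k → 0`).  Witnesses: `b₀ = 2`, `ℓ = min(ℓ_T, ℓ_N, 1)`, `M₀^crux = max(M₀', M₁ᵀ, M₁ᴺ)`,
`R = max(R_B, R_T, R_N)`.

Disproof used (`Cruxes/NegativeCellsDilute/Disproof.lean` v4, cdisprove, NO KILL): § 2 `withoutPin_holds` —
honoured: the pin is stub B on the same `reg`, located by C; § 1 `pin_window` — consistent (`mcrit → 0`,
probes `→ 0⁻`); landed `Theorems/NegativeCellsDilute/Negative/CellPositivity` — no stub asserts a defect or a
crossing at a positive bare mass (crossing events are at `μ' ≥` valence mass and are only bounded ABOVE;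
for a junk `reg` with positive valence masses they are empty and T, N hold trivially, while C's GAP-DOWN
fails).  No `_false_without_` theorem exists for this crux.  Negatives index (4 refuted QuantumFields
statements: 9494, 9599, 9603, 9665): none concerns cell signs, real modes or flowed fields.
-/

noncomputable section

namespace Summit.QuantumFields.QCD.Cruxes.NegativeCellsDilute.PriceTheSeedNotTheSpot

open scoped BigOperators Topology Classical Matrix
open Filter MeasureTheory Matrix
open Literature.MathematicalPhysics.QuantumLattice Literature.MathematicalPhysics.QuantumFieldTheory
  Literature.Probability.LatticeModels
open Summit.QuantumFields.QCD.Theses.NestedDissectionSea (NegativeCellsDilute SignDefectForcesCrossing)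

/-! ## Registered stubs (tree vocabulary only; `sorry` occurs nowhere else in this file)

Conventions shared by all stubs: tree normalisation `β = 2/g₀²`; odd tori of side `2S+1`; valence/sea bare
masses `m_f(k) = reg.mcrit k + reg.a k * m f / reg.Zm k`; the phase-quenched weight
`wt U = ∏_f ‖det D_W(U, m_f(k), 1)‖` against `wilsonMeasure … (reg.β k)`; a CROSSING of the corner-`0` box `s`
above `μ` is `∃ μ' ≥ μ, det (wilsonCell U μ' 0 s) = 0 ∨ ∃ c, det (wilsonCell U μ' (halfCorner s c)
(halfSides s c)) = 0` (the cover event of `SignDefectForcesCrossing`); a SEED of the box at tolerance `η₀`,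
onset `ρ₀` is a scale `ρ ∈ [ρ₀, Σ_i s_i]`, a sub-box `(x, r)` inside the box with `ρ/2 ≤ r_i ≤ ρ` and a
spinor `ψ ≠ 0` on it with `‖(C − Cᴴ)ψ‖² ≤ (2η₀/ρ)²‖ψ‖²`, `C = wilsonCell (wilsonFlow (ρ²/8) U) 0 x r`;
GAP-UP / GAP-DOWN events compare the smallest singular value of the whole-torus matrix `D_W(U, μ, 1)` at two
probe masses (`∃ τ, (∃ v ≠ 0, ‖D(μ₁)v‖² ≤ τ²‖v‖²) ∧ (∀ v, (τ + t)²‖v‖² ≤ ‖D(μ₂)v‖²)`, i.e.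
`σ_min D(μ₂) ≥ σ_min D(μ₁) + t`). -/


/-- **stub_seedActionFloor (S′ — the ZERO-MODE ACTION FLOOR; deterministic; the line's first check).**
There are a floor `A₀ > 16π²/9`, a tolerance `η₀ > 0` and an onset `ρ₀ > 0` such that for every `SU(3)` field
`U` on a four-torus of side `N > 8ρ`, every scale `ρ ≥ ρ₀` and every sub-box `(x, r)` with `ρ/2 ≤ r_i ≤ ρ`:
if the sub-box carries a spinor `ψ ≠ 0` with `‖(C − Cᴴ)ψ‖² ≤ (2η₀/ρ)²‖ψ‖²`, `C` the massless Dirichlet Wilson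
cell of the FLOWED field `V = wilsonFlow (ρ²/8) U` on it (`½(C − Cᴴ)` is its naive anti-Hermitian Dirac part,
mass-independent), then the Wilson plaquette action of `V` inside the concentric box of side `5ρ` is `≥ A₀`.
Why plausible: `V` is smooth at scale `ρ`; lattice Lichnerowicz `‖Nψ‖² = ‖∇ψ‖² + ½⟨ψ, σ·F̂ψ⟩` + Kato + the
4-d Sobolev inequality + the Dirichlet floor `‖∇|ψ|‖ ≳ (2π/ρ)‖ψ‖` force `Σ|F̂|² ≥ const`; Bogomolny gives
`4π² ≈ 39.5 > 17.55 = 16π²/9` for `|Q_loc| = 1` lumps, the crude Sobolev constant lands AT the threshold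
(`≈ 0.44·4π²`, TRIAGE r1-1 sharpen 2; r1-3) — the sharp constant / the small-`η₀` limit is the work.  Units:
tree `wilsonAction` content of one instanton `= 4π²` (`β·wilsonAction = 8π²/g₀²`); `16π²/9 = 1/b₀(N_f=3) >
1/b₀(N_f=2)`, so one floor serves both flavour numbers.  Sanity (no vacuity, no junk): the free field is NOT
a seed for `η₀ < 2π` (σ_min of `C − Cᴴ` on an `r`-box is `4 sin(π/r)`), single-site sub-boxes (where
`C − Cᴴ = 0`) are excluded by `ρ ≤ 2 r_i` once `ρ₀ ≥ 5`, and genuine lumps of size `ρ → ∞` ARE seeds for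
every `η₀ > 0` (lattice artefacts `O(1/ρ²)`).  Size M–L.  Cheapest falsifier: a smooth lattice field with
an `η₀/ρ`-approximate naive kernel vector in a `ρ`-box and flowed local action `< 17.55` (I–Ā valley
configurations; their near-zero pair splits as the action drops).  Leans on: `wilsonFlow`
(`wilsonAction_wilsonFlow_le`, `wilsonFlow_gaugeTransform`), `wilsonCell`, `wilsonBox`, `siteBox`,
`plaquetteHolonomy`, `fundamentalRep`; Mathlib matrix/`Finset` sums. -/
theorem stub_seedActionFloor :
    ∃ A₀ : ℝ, 16 * Real.pi ^ 2 / 9 < A₀ ∧ ∃ η₀ : ℝ, 0 < η₀ ∧ ∃ ρ₀ : ℝ, 0 < ρ₀ ∧ ∀ (N : ℕ) [NeZero N] (U : GaugeConfig 4 N SU3) (ρ : ℕ), ρ₀ ≤ (ρ : ℝ) → 8 * ρ < N → ∀ (x : TorusSite 4 N) (r : Fin 4 → ℕ), (∀ i, r i ≤ ρ ∧ ρ ≤ 2 * r i) → (∃ ψ : {p // wilsonBox x r p} → ℂ, ψ ≠ 0 ∧ ∑ p, ‖((wilsonCell (wilsonFlow ((ρ : ℝ) ^ 2 / 8) U) 0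 x r - (wilsonCell (wilsonFlow ((ρ : ℝ) ^ 2 / 8) U) 0 x r)ᴴ) *ᵥ ψ) p‖ ^ 2 ≤ (2 * η₀ / ρ) ^ 2 * ∑ p, ‖ψ p‖ ^ 2) → A₀ ≤ ∑ y : TorusSite 4 N, if siteBox (fun i => x i - ((2 * ρ : ℕ) : ZMod N)) (fun _ => 5 * ρ) y then ∑ μ : Fin 4, ∑ ν : Fin 4, (if μ < ν then (3 - ((fundamentalRep (Fin 3) (plaquetteHolonomy (wilsonFlow ((ρ : ℝ) ^ 2 / 8) U) y μ ν)).trace).re) else 0) else 0 := by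
  sorry

/-- **stub_sharpCriticalLine (C — THE LOCATED LINE; constructs `reg`; the V-shaped Hermitian gap).**
For `N_f ∈ {2,3}` there is ONE mass-independent regularisation `reg` (leading-log `Z_m`, two-loop asymptotic
scaling) with `mcrit k → 0` and a threshold `M₀ ≥ 0` such that for every sea-mass tuple `m > M₀`:
(GAP-UP) for some `c > 0` and all `M₀ < M < M'` there is a physical size `R` (depending on `M, M'`: the
p-regime `(M' − M)R ≫ 1`) such that, eventually in `k`, on the odd tori of physical side in `[R, 2R]` and under
the phase-quenched weight, with probability `≥ 7/8` the smallest singular value of the whole-torus matrix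
`D_W(U, ·, 1)` at `mcrit + a_k M'/Z_m` exceeds the one at `mcrit + a_k M/Z_m` by `c·a_k(M' − M)/Z_m`;
(GAP-DOWN) the same with probes `mcrit − a_k M/Z_m`, `mcrit − a_k M'/Z_m`.  Informally: around `mcrit(k)` the
Hermitian Wilson gap `λ_min|γ₅ D_W(μ)|` is V-shaped with slopes `≥ c` to precision `a_k/Z_m(k)` — the lattice
practitioner's `κ_c` (Del Debbio–Giusti–Lüscher–Petronzio–Tantalo 2005 gap distributions; MohlerSchaefer2020 §5,
gap `∝ Z_A m`), made a clause.  Mechanism for the natural witness (`mcrit k :=` the minimiser of the median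
gap on a reference torus at a reference sea mass; sea-mass dependence is `o(a_k/Z_m)` for fixed `m`, `β`, `Z_m`
chosen canonically): for topologically trivial gapped configurations the lowest modes of `γ₅ D_W(μ)` are the
dressed `p = 0` multiplet, `|λ| = ((μ − m_c)² + p_eff²)^{1/2}` with holonomy rounding `p_eff ≍ a_k/R ≪
a_k M/Z_m` in the p-regime, higher `p` modes lying above (`(Δ ∓ q/2)² + q` is increasing in `q = p²`), and
`|dλ/dμ| ≤ 1` (chirality); GAP-UP fails only on early crossers above the upper probe (rare: seeds of size
`≤ R/a_k` have count `O((RΛ)^b)` and conditional lateness, seedless ones are `O(a^∞)` — the torus-scale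
shadow of T and N), GAP-DOWN only on index modes crossing BETWEEN the lower probes (lumps of physical size
`ρ_*(M') ≤ ρ ≤ ρ_*(M) → 0`, density `→ 0` since `b > 4`) or Aoki-band effects (width `∝ a³ ≪ a/Z_m`).
Why it might fail: a k-uniform slope `c` needs the gap mode's chirality bounded below; early crossers at the
torus scale must be rare already at probability `1/8` (no rate needed).  Junk audit: `mcrit ≡ 0`, `≡ +1`,
deep-supercritical and `ε`-regime witnesses all fail GAP-DOWN or GAP-UP (V tip elsewhere / no resolvable
slope).  Size L.  Leans on: `QCDRegularisation`, `canonicalAF_hasMassScaling`, `afBeta`, `wilsonDirac`,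
`fermionDet`, `wilsonMeasure`, `KineticEdge`; landed `Negative/PinWindow` (consistent). -/
theorem stub_sharpCriticalLine :
    ∀ Nf : ℕ, (Nf = 2 ∨ Nf = 3) → ∃ reg : QCDRegularisation Nf, reg.HasMassScaling ∧ (reg.scheme 0 0 0).HasAsymptoticScaling ∧ Tendsto reg.mcrit atTop (𝓝 0) ∧ ∃ M₀ : ℝ, 0 ≤ M₀ ∧ ∀ m : Fin Nf → ℝ, (∀ f, M₀ < m f) → (∃ c : ℝ, 0 < c ∧ ∀ M M' : ℝ, M₀ < M → M < M' → ∃ R : ℝ, 0 < R ∧ ∀ᶠ k : ℕ in atTop, ∀ S : ℕ, R ≤ reg.a k * (2 * S + 1) → reg.a k * (2 * S + 1) ≤ 2 * R → let μW := wilsonMeasure (d := 4) (L := 2 * S + 1) (fundamentalRep (Fin 3)) (reg.β k); let wt : GaugeConfig 4 (2 * S + 1) SU3 → ℝ := fun U => ∏ f, ‖fermionDet (wilsonDirac (fundamentalRep (Fin 3)) U (reg.mcrit k + reg.a k * m f / reg.Zm k) 1)‖; 7 / 8 ≤ (∫ U, (if (∃ τ : ℝ, 0 ≤ τ ∧ (∃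 v : TorusSite 4 (2 * S + 1) × Fin 3 × Fin 4 → ℂ, v ≠ 0 ∧ ∑ i, ‖(wilsonDirac (fundamentalRep (Fin 3)) U (reg.mcrit k + reg.a k * M / reg.Zm k) 1 *ᵥ v) i‖ ^ 2 ≤ τ ^ 2 * ∑ i, ‖v i‖ ^ 2) ∧ (∀ v : TorusSite 4 (2 * S + 1) × Fin 3 × Fin 4 → ℂ, (τ + c * (reg.a k * (M' - M) / reg.Zm k)) ^ 2 * ∑ i, ‖v i‖ ^ 2 ≤ ∑ i, ‖(wilsonDirac (fundamentalRep (Fin 3)) U (reg.mcrit k + reg.a k * M' / reg.Zm k) 1 *ᵥ v) i‖ ^ 2)) then (1 : ℝ) else 0) * wt U ∂μW) / (∫ U, wt U ∂μW)) ∧ (∃ c : ℝ, 0 < c ∧ ∀ M M' : ℝ, M₀ < M → M < M' → ∃ R : ℝ, 0 < R ∧ ∀ᶠ k : ℕ in atTop, ∀ S : ℕ, R ≤ reg.a k * (2 * S + 1) → reg.a k * (2 * S + 1) ≤ 2 * R → let μW := wilsonMeasure (d := 4) (L := 2 * S + 1) (fundamentalRep (Fin 3)) (reg.β k); let wt : GaugeConfig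 4 (2 * S + 1) SU3 → ℝ := fun U => ∏ f, ‖fermionDet (wilsonDirac (fundamentalRep (Fin 3)) U (reg.mcrit k + reg.a k * m f / reg.Zm k) 1)‖; 7 / 8 ≤ (∫ U, (if (∃ τ : ℝ, 0 ≤ τ ∧ (∃ v : TorusSite 4 (2 * S + 1) × Fin 3 × Fin 4 → ℂ, v ≠ 0 ∧ ∑ i, ‖(wilsonDirac (fundamentalRep (Fin 3)) U (reg.mcrit k - reg.a k * M / reg.Zm k) 1 *ᵥ v) i‖ ^ 2 ≤ τ ^ 2 * ∑ i, ‖v i‖ ^ 2) ∧ (∀ v : TorusSite 4 (2 * S + 1) × Fin 3 × Fin 4 → ℂ, (τ + c * (reg.a k * (M' - M) / reg.Zm k)) ^ 2 * ∑ i, ‖v i‖ ^ 2 ≤ ∑ i, ‖(wilsonDirac (fundamentalRep (Fin 3)) U (reg.mcrit k - reg.a k * M' / reg.Zm k) 1 *ᵥ v) i‖ ^ 2)) then (1 : ℝ) else 0) * wt U ∂μW) / (∫ U, wt U ∂μW)) := by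
  sorry

/-- **stub_parityPinOnLine (B — the (b)-partner: PARITY PIN on a located line).**  For `N_f ∈ {2,3}`, EVERY
regularisation `reg` with leading-log `Z_m` and asymptotic scaling whose line is located by GAP-UP ∧ GAP-DOWN
(as in `stub_sharpCriticalLine`) with threshold `M₀` satisfies clause (b) of the crux from some threshold
`M₀' ≥ M₀` on: for every `m > M₀'` there is `R > 0` such that for every `M > M₀'`, eventually in `k`, on
EVERY odd torus of physical side `≥ R` (all volumes), `P(Re det D_W(U, mcrit k − a_k M/Z_m k, 1) < 0) ≥ 1/4`
under the phase-quenched weight — VERBATIM the crux's second conjunct (so the composition hands it over by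
`exact`).  Mechanism: `Re det < 0` iff an odd number of real eigenvalues crossed above the probe
(`WilsonDeterminantSign_holds`; `SignDefectForcesCrossing` at the torus level); GAP-UP ∧ GAP-DOWN pin the dressed
line to `mcrit ± a_k M₀/Z_m`, so a physical distance `M − M₀` below it every index mode of a lump of physical
size `> ρ_*(M − M₀) → 0` has crossed, early crossers above are rare, the dressed `p = 0` multiplet and pair-born
(Aoki) modes contribute even counts: the sign is `(−1)^{Q_eff}` up to a rare correction, and
`P(Q_eff odd) ≥ 1/4` once `χ_t(m) R⁴ ≳ 0.35` (`R` is chosen after `m`; `χ_t ∝ m Σ/N_f > 0` for `m > 0`),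
uniformly in larger volumes (`→ 1/2`).  This is θ = π / `χ_t > 0` content — YM-topology hard, the clause the
standing disprover showed to be the crux's only junk-proof content (`Disproof.withoutPin_holds`).  Why it might
fail: index modes crossing over a band `≫ a_k M/Z_m`; no lower bound on lump activity is available from
small-ball arguments (`UnitaryHaarSmallBall`).  Size L–XL; same content as `EarlyCrosserLaw` (b) and the crux
idea `sign-mobility-identity` (block-parity floor + ratio mixing), which can be run as its proof.  Leans on:
`WilsonDeterminantSign_holds`, `fermionDet_wilsonDirac_eq_sign_mul`, `wilsonSpectralIndex`, landed
`Negative/PinWindow`, `Negative/CellPositivity`. -/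
theorem stub_parityPinOnLine :
    ∀ Nf : ℕ, (Nf = 2 ∨ Nf = 3) → ∀ reg : QCDRegularisation Nf, reg.HasMassScaling → (reg.scheme 0 0 0).HasAsymptoticScaling → ∀ M₀ : ℝ, 0 ≤ M₀ → (∀ m : Fin Nf → ℝ, (∀ f, M₀ < m f) → (∃ c : ℝ, 0 < c ∧ ∀ M M' : ℝ, M₀ < M → M < M' → ∃ R : ℝ, 0 < R ∧ ∀ᶠ k : ℕ in atTop, ∀ S : ℕ, R ≤ reg.a k * (2 * S + 1) → reg.a k * (2 * S + 1) ≤ 2 * R → let μW := wilsonMeasure (d := 4) (L := 2 * S + 1) (fundamentalRep (Fin 3)) (reg.β k); let wt : GaugeConfig 4 (2 * S + 1) SU3 → ℝ := fun U => ∏ f, ‖fermionDet (wilsonDirac (fundamentalRep (Fin 3)) U (reg.mcrit k + reg.a k * m f / reg.Zm k) 1)‖; 7 / 8 ≤ (∫ U, (if (∃ τ : ℝ, 0 ≤ τ ∧ (∃ v : TorusSite 4 (2 * S + 1) × Fin 3 × Fin 4 → ℂ, v ≠ 0 ∧ ∑ i, ‖(wilsonDirac (fundamentalRep (Fin 3))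 U (reg.mcrit k + reg.a k * M / reg.Zm k) 1 *ᵥ v) i‖ ^ 2 ≤ τ ^ 2 * ∑ i, ‖v i‖ ^ 2) ∧ (∀ v : TorusSite 4 (2 * S + 1) × Fin 3 × Fin 4 → ℂ, (τ + c * (reg.a k * (M' - M) / reg.Zm k)) ^ 2 * ∑ i, ‖v i‖ ^ 2 ≤ ∑ i, ‖(wilsonDirac (fundamentalRep (Fin 3)) U (reg.mcrit k + reg.a k * M' / reg.Zm k) 1 *ᵥ v) i‖ ^ 2)) then (1 : ℝ) else 0) * wt U ∂μW) / (∫ U, wt U ∂μW)) ∧ (∃ c : ℝ, 0 < c ∧ ∀ M M' : ℝ, M₀ < M → M < M' → ∃ R : ℝ, 0 < R ∧ ∀ᶠ k : ℕ in atTop, ∀ S : ℕ, R ≤ reg.a k * (2 * S + 1) → reg.a k * (2 * S + 1) ≤ 2 * R → let μW := wilsonMeasure (d := 4) (L := 2 * S + 1) (fundamentalRep (Fin 3)) (reg.β k); let wt : GaugeConfig 4 (2 * S + 1) SU3 → ℝ := fun U => ∏ f, ‖fermionDet (wilsonDirac (fundamentalRep (Fin 3)) U (reg.mcrit k + reg.a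 k * m f / reg.Zm k) 1)‖; 7 / 8 ≤ (∫ U, (if (∃ τ : ℝ, 0 ≤ τ ∧ (∃ v : TorusSite 4 (2 * S + 1) × Fin 3 × Fin 4 → ℂ, v ≠ 0 ∧ ∑ i, ‖(wilsonDirac (fundamentalRep (Fin 3)) U (reg.mcrit k - reg.a k * M / reg.Zm k) 1 *ᵥ v) i‖ ^ 2 ≤ τ ^ 2 * ∑ i, ‖v i‖ ^ 2) ∧ (∀ v : TorusSite 4 (2 * S + 1) × Fin 3 × Fin 4 → ℂ, (τ + c * (reg.a k * (M' - M) / reg.Zm k)) ^ 2 * ∑ i, ‖v i‖ ^ 2 ≤ ∑ i, ‖(wilsonDirac (fundamentalRep (Fin 3)) U (reg.mcrit k - reg.a k * M' / reg.Zm k) 1 *ᵥ v) i‖ ^ 2)) then (1 : ℝ) else 0) * wt U ∂μW) / (∫ U, wt U ∂μW))) → ∃ M₀' : ℝ, M₀ ≤ M₀' ∧ ∀ m : Fin Nf → ℝ, (∀ f, M₀' < m f) → ∃ R : ℝ, 0 < R ∧ ∀ M : ℝ, M₀' < M → ∀ᶠ k : ℕ in Filter.atTop, ∀ S : ℕ,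 R ≤ reg.a k * (2 * S + 1) → let N : ℕ := 2 * S + 1; let mq : Fin Nf → ℝ := fun f => reg.mcrit k + reg.a k * m f / reg.Zm k; let wt : GaugeConfig 4 N (Matrix.specialUnitaryGroup (Fin 3) ℂ) → ℝ := fun U => ∏ f, ‖fermionDet (wilsonDirac (fundamentalRep (Fin 3)) U (mq f) 1)‖; (1 / 4 : ℝ) ≤ (∫ U, (if (fermionDet (wilsonDirac (fundamentalRep (Fin 3)) U (reg.mcrit k - reg.a k * M / reg.Zm k) 1)).re < 0 then (1 : ℝ) else 0) * wt U ∂(wilsonMeasure (d := 4) (L := N) (fundamentalRep (Fin 3)) (reg.β k))) / (∫ U, wt U ∂(wilsonMeasure (d := 4) (L := N) (fundamentalRep (Fin 3)) (reg.β k))) := by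
  sorry

/-- **stub_seededChannel (T — SEEDED EARLY CROSSINGS HAVE PHYSICAL DENSITY × o(1)).**  Given the action floor
(the statement of `stub_seedActionFloor` for SOME `A₀ > 16π²/9`, `η₀`, `ρ₀`, taken as hypothesis so that the
floor stays a separately registered obligation), for `N_f ∈ {2,3}`, every regularisation with leading-log
`Z_m`, asymptotic scaling, `mcrit → 0` and a GAP-UP-located line (threshold `M₀`) admits `M₁`, a physical
window `ℓ > 0`, constants `C ≥ 0`, `θ > 0` and a NULL SEQUENCE `η_T(k) → 0` such that for every sea-mass tuple
`m > M₁`, on all odd tori of physical side `≥ R(m)`, eventually in `k`, for every roughly cubic box `s`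
(`2 ≤ s_i ≤ N`, `s_i a_k ≤ ℓ`, `s_i ≤ 4 s_{i'}`) the event "CROSSING above some valence mass `m_f(k)` AND the
box contains a SEED (tolerance `η₀`, onset `ρ₀`)" lies in a measurable set of phase-quenched probability
`≤ C (s₀ a_k)^θ η_T(k)`.  Mechanism: by the floor a seed of scale `ρ` carries flowed action `≥ A₀` in a `5ρ`-box,
an event of density `≲ (ρ a_k Λ)^{4 b₀ A₀ (1−o(1))}` per `ρ`-block (large-field / semiclassical bound for the
flowed field under the phase-quenched `SU(3)` measure — `|det|` only suppresses zero modes), and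
`4 b₀ A₀ > 4` for both `N_f`, so the expected number of DISTINCT seeds (lumps, each seen by `≍ ρ⁴` sub-boxes —
count lumps, do not union-bound over corners) in a box of side `s` is `≲ (s a_k Λ)^θ`, UNIFORMLY in `k`; a seed
of size `ρ` crosses at `m_c − c_I/ρ²` (`c_I → 0.75`; I–Ā molecules give complex pairs, not real crossers) and
reaches `m_f(k) ≥ m_c + a_k(m_f − M₀)/Z_m − o(a/Z_m)` (location from GAP-UP: were `m_c` higher, trivial gapped
configurations would show a decreasing gap between two probes below it) only through a first-order chiral
response of `z(ρ, k) → ∞` standard deviations uniformly in `ρ ≤ Σ s_i ≤ 16ℓ/a_k` (route L3–L4; TRIAGE r1-2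
sharpen 3: price with `c₁ g(ρ)/ρ²`, not the tadpole constant), whence `η_T(k) → 0` (a power of `a_k` whose
exponent is not needed).  Why it might fail: the `|det|`-reweighted large-field bound at instanton strength is a
Bałaban-class statement never proved for `SU(3)`; the conditional moderate deviation must be uniform over
seeded block fields.  Size XL.  Leans on: `wilsonFlow` (`continuous_wilsonFlow`, `measurable_wilsonFlow` for
the measurable superset), `wilsonCell`, `halfCorner`, `halfSides`, `KineticEdge`, `ChiralityPairing`,
`QCDRegularisation`, `DiluteInstantonGasDivergence` barrier (evaded: sizes `≤ 16ℓ/a_k`, upper bound only). -/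
theorem stub_seededChannel :
    ∀ (A₀ η₀ ρ₀ : ℝ), 16 * Real.pi ^ 2 / 9 < A₀ → 0 < η₀ → 0 < ρ₀ → (∀ (N : ℕ) [NeZero N] (U : GaugeConfig 4 N SU3) (ρ : ℕ), ρ₀ ≤ (ρ : ℝ) → 8 * ρ < N → ∀ (x : TorusSite 4 N) (r : Fin 4 → ℕ), (∀ i, r i ≤ ρ ∧ ρ ≤ 2 * r i) → (∃ ψ : {p // wilsonBox x r p} → ℂ, ψ ≠ 0 ∧ ∑ p, ‖((wilsonCell (wilsonFlow ((ρ : ℝ) ^ 2 / 8) U) 0 x r - (wilsonCell (wilsonFlow ((ρ : ℝ) ^ 2 / 8) U) 0 x r)ᴴ) *ᵥ ψ) p‖ ^ 2 ≤ (2 * η₀ / ρ) ^ 2 * ∑ p, ‖ψ p‖ ^ 2) → A₀ ≤ ∑ y : TorusSite 4 N, if siteBox (fun i => x i - ((2 * ρ : ℕ) : ZMod N)) (fun _ => 5 * ρ) y then ∑ μ : Fin 4, ∑ ν : Fin 4, (if μ < ν then (3 - ((fundamentalRep (Fin 3) (plaquetteHolonomy (wilsonFlow ((ρ : ℝ) ^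 2 / 8) U) y μ ν)).trace).re) else 0) else 0) → ∀ Nf : ℕ, (Nf = 2 ∨ Nf = 3) → ∀ reg : QCDRegularisation Nf, reg.HasMassScaling → (reg.scheme 0 0 0).HasAsymptoticScaling → Tendsto reg.mcrit atTop (𝓝 0) → ∀ M₀ : ℝ, 0 ≤ M₀ → (∀ m : Fin Nf → ℝ, (∀ f, M₀ < m f) → (∃ c : ℝ, 0 < c ∧ ∀ M M' : ℝ, M₀ < M → M < M' → ∃ R : ℝ, 0 < R ∧ ∀ᶠ k : ℕ in atTop, ∀ S : ℕ, R ≤ reg.a k * (2 * S + 1) → reg.a k * (2 * S + 1) ≤ 2 * R → let μW := wilsonMeasure (d := 4) (L := 2 * S + 1) (fundamentalRep (Fin 3)) (reg.β k); let wt : GaugeConfig 4 (2 * S + 1) SU3 → ℝ := fun U => ∏ f, ‖fermionDet (wilsonDirac (fundamentalRep (Fin 3)) U (reg.mcrit k + reg.a k * m f / reg.Zm k) 1)‖; 7 / 8 ≤ (∫ U, (if (∃ τ : ℝ, 0 ≤ τ ∧ (∃ v : TorusSite 4 (2 * S + 1) × Fin 3 × Fin 4 → ℂ, v ≠ 0 ∧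 ∑ i, ‖(wilsonDirac (fundamentalRep (Fin 3)) U (reg.mcrit k + reg.a k * M / reg.Zm k) 1 *ᵥ v) i‖ ^ 2 ≤ τ ^ 2 * ∑ i, ‖v i‖ ^ 2) ∧ (∀ v : TorusSite 4 (2 * S + 1) × Fin 3 × Fin 4 → ℂ, (τ + c * (reg.a k * (M' - M) / reg.Zm k)) ^ 2 * ∑ i, ‖v i‖ ^ 2 ≤ ∑ i, ‖(wilsonDirac (fundamentalRep (Fin 3)) U (reg.mcrit k + reg.a k * M' / reg.Zm k) 1 *ᵥ v) i‖ ^ 2)) then (1 : ℝ) else 0) * wt U ∂μW) / (∫ U, wt U ∂μW))) → ∃ M₁ : ℝ, ∃ ℓ : ℝ, 0 < ℓ ∧ ∃ C : ℝ, 0 ≤ C ∧ ∃ θ : ℝ, 0 < θ ∧ ∃ η : ℕ → ℝ, (∀ k, 0 ≤ η k) ∧ Tendsto η atTop (𝓝 0) ∧ ∀ m : Fin Nf → ℝ, (∀ f, M₁ < m f) → ∃ R : ℝ, 0 < R ∧ ∀ᶠ k : ℕ in atTop, ∀ S : ℕ, R ≤ reg.a k * (2 * S + 1) → let μW := wilsonMeasure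 (d := 4) (L := 2 * S + 1) (fundamentalRep (Fin 3)) (reg.β k); let wt : GaugeConfig 4 (2 * S + 1) SU3 → ℝ := fun U => ∏ f, ‖fermionDet (wilsonDirac (fundamentalRep (Fin 3)) U (reg.mcrit k + reg.a k * m f / reg.Zm k) 1)‖; ∀ s : Fin 4 → ℕ, (∀ i, 2 ≤ s i ∧ s i ≤ 2 * S + 1 ∧ (s i : ℝ) * reg.a k ≤ ℓ) → (∀ i i', s i ≤ 4 * s i') → ∃ A : Set (GaugeConfig 4 (2 * S + 1) SU3), MeasurableSet A ∧ (∀ U : GaugeConfig 4 (2 * S + 1) SU3, ((∃ f : Fin Nf, ∃ μ' : ℝ, reg.mcrit k + reg.a k * m f / reg.Zm k ≤ μ' ∧ ((wilsonCell U μ' 0 s).det = 0 ∨ ∃ c : Fin 4 → Bool, (wilsonCell U μ' (halfCorner s c) (halfSides s c)).det = 0)) ∧ (∃ ρ : ℕ, ρ₀ ≤ (ρ : ℝ) ∧ ρ ≤ s 0 + s 1 + s 2 + s 3 ∧ ∃ (x : TorusSite 4 (2 * S + 1)) (r : Fin 4 → ℕ), (∀ i, r i ≤ ρ ∧ ρ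 ≤ 2 * r i) ∧ (∀ y, siteBox x r y → siteBox 0 s y) ∧ ∃ ψ : {p // wilsonBox x r p} → ℂ, ψ ≠ 0 ∧ ∑ p, ‖((wilsonCell (wilsonFlow ((ρ : ℝ) ^ 2 / 8) U) 0 x r - (wilsonCell (wilsonFlow ((ρ : ℝ) ^ 2 / 8) U) 0 x r)ᴴ) *ᵥ ψ) p‖ ^ 2 ≤ (2 * η₀ / ρ) ^ 2 * ∑ p, ‖ψ p‖ ^ 2)) → U ∈ A) ∧ (∫ U, (if U ∈ A then (1 : ℝ) else 0) * wt U ∂μW) / (∫ U, wt U ∂μW) ≤ C * ((s 0 : ℝ) * reg.a k) ^ θ * η k := by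
  sorry

/-- **stub_seedlessChannel (N — SEEDLESS EARLY CROSSINGS ARE `O(a_k^∞)` PER LATTICE POSITION; the line's
hardest stub).**  For every tolerance `η₀ > 0` and onset `ρ₀ > 0`, for `N_f ∈ {2,3}` and every
regularisation with leading-log `Z_m`, asymptotic scaling, `mcrit → 0` and a GAP-UP-located line (threshold
`M₀`), there are `M₁`, a window `ℓ > 0` and `η_N(k) ≥ 0` with `η_N(k)/a_k^n → 0` FOR EVERY `n` such that for
every `m > M₁`, on all odd tori of physical side `≥ R(m)`, eventually in `k`, for every roughly cubic window
box the event "CROSSING above some `m_f(k)` AND NO SEED in the box (tolerance `η₀`, onset `ρ₀`)" lies in a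
measurable set of phase-quenched probability `≤ η_N(k)`.  Mechanism (card channels W + D): by KineticEdge a
crossing at `|μ'| ≤ |m_f(k)| → 0` lives at scale `ρ ≥ ρ_min(k) = π(2/|μ'|)^{1/2} → ∞` (this is where
`mcrit → 0` enters; onset only logarithmic in `a_k`, TRIAGE r1-1 sharpen 3); DRESSED Dirac balance
`(L + μ')w = −N w` with `‖(C − Cᴴ)ψ‖ > (2η₀/ρ)‖ψ‖` on every sub-box at the mode's scale (no seed) forces the
block-averaged dressed Wilson mass below `|μ'|` by `≥ c_w(η₀)/ρ` on the support of the mode (wall level of a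
supercritical/TI island, Kaplan–QHZ dictionary; the crude variance form `≥ η₀²/(8ρ)²·O(1)` already gives a
super-linear rate) or the mode to load a mesoscopic hot region of side `≳ ρ_min` (kinematically impossible
below that side): CLT/LD events of rate `≍ c ρ_min² β_k` resp. `≍ ε₀ ρ_min⁴ β_k`, super-linear in `β_k`, against
the linear entropy `(4 + n) β_k/(4 b₀)` of positions and of `a_k^{−n}` — hence `O(a_k^∞)`.  The locator GAP-UP
gives `m_c^{dressed}(k) ≤ mcrit k + a_k M₀/Z_m + o` natively (trivial gapped configurations are V-shaped).
For `η₀ ≥ 2π` or `ρ₀ ≤ 4` the no-seed event is EMPTY (free boxes resp. single sites are seeds) and the stub is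
trivially true — the chain self-regulates, since the floor is then false and T is only invoked at the floor's
parameters.  Why it might fail (the disprover's "fifth population"): an abundant small-field configuration class
binding SEEDLESS real modes within `O(a_k m/Z_m)` of the line — pair-collision (Aoki) modes with a band `∝ a`
rather than `a³`, or few-plaquette clusters binding near-threshold real modes (excluded numerically by
BNN2000 `λ > 1.1`, kinematically by `TipNoBinding`-type bounds).  Size XL.  Leans on: `wilsonFlow`,
`wilsonCell`, `KineticEdge`, `SpectralDefectExtinction.TipNoBinding` (sibling crux, 4 stubs landed),
`QCDRegularisation`; barriers `AokiPhaseDichotomy` (the W island IS a local Aoki/TI island, priced not denied),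
`NoContinuousLatticeTopologicalCharge` (seed = flowed near-kernel event, no integer charge used). -/
theorem stub_seedlessChannel :
    ∀ (η₀ ρ₀ : ℝ), 0 < η₀ → 0 < ρ₀ → ∀ Nf : ℕ, (Nf = 2 ∨ Nf = 3) → ∀ reg : QCDRegularisation Nf, reg.HasMassScaling → (reg.scheme 0 0 0).HasAsymptoticScaling → Tendsto reg.mcrit atTop (𝓝 0) → ∀ M₀ : ℝ, 0 ≤ M₀ → (∀ m : Fin Nf → ℝ, (∀ f, M₀ < m f) → (∃ c : ℝ, 0 < c ∧ ∀ M M' : ℝ, M₀ < M → M < M' → ∃ R : ℝ, 0 < R ∧ ∀ᶠ k : ℕ in atTop, ∀ S : ℕ, R ≤ reg.a k * (2 * S + 1) → reg.a k * (2 * S + 1) ≤ 2 * R → let μW := wilsonMeasure (d := 4) (L := 2 * S + 1) (fundamentalRep (Fin 3)) (reg.β k); let wt : GaugeConfig 4 (2 * S + 1) SU3 → ℝ := fun U => ∏ f, ‖fermionDet (wilsonDirac (fundamentalRep (Fin 3)) U (reg.mcrit k + reg.a k * m f / reg.Zm k) 1)‖; 7 / 8 ≤ (∫ U, (if (∃ τ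 : ℝ, 0 ≤ τ ∧ (∃ v : TorusSite 4 (2 * S + 1) × Fin 3 × Fin 4 → ℂ, v ≠ 0 ∧ ∑ i, ‖(wilsonDirac (fundamentalRep (Fin 3)) U (reg.mcrit k + reg.a k * M / reg.Zm k) 1 *ᵥ v) i‖ ^ 2 ≤ τ ^ 2 * ∑ i, ‖v i‖ ^ 2) ∧ (∀ v : TorusSite 4 (2 * S + 1) × Fin 3 × Fin 4 → ℂ, (τ + c * (reg.a k * (M' - M) / reg.Zm k)) ^ 2 * ∑ i, ‖v i‖ ^ 2 ≤ ∑ i, ‖(wilsonDirac (fundamentalRep (Fin 3)) U (reg.mcrit k + reg.a k * M' / reg.Zm k) 1 *ᵥ v) i‖ ^ 2)) then (1 : ℝ) else 0) * wt U ∂μW) / (∫ U, wt U ∂μW))) → ∃ M₁ : ℝ, ∃ ℓ : ℝ, 0 < ℓ ∧ ∃ η : ℕ → ℝ, (∀ k, 0 ≤ η k) ∧ (∀ n : ℕ, Tendsto (fun k => η k / reg.a k ^ n) atTop (𝓝 0)) ∧ ∀ m : Fin Nf → ℝ, (∀ f, M₁ < m f) → ∃ R : ℝ, 0 < R ∧ ∀ᶠ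 k : ℕ in atTop, ∀ S : ℕ, R ≤ reg.a k * (2 * S + 1) → let μW := wilsonMeasure (d := 4) (L := 2 * S + 1) (fundamentalRep (Fin 3)) (reg.β k); let wt : GaugeConfig 4 (2 * S + 1) SU3 → ℝ := fun U => ∏ f, ‖fermionDet (wilsonDirac (fundamentalRep (Fin 3)) U (reg.mcrit k + reg.a k * m f / reg.Zm k) 1)‖; ∀ s : Fin 4 → ℕ, (∀ i, 2 ≤ s i ∧ s i ≤ 2 * S + 1 ∧ (s i : ℝ) * reg.a k ≤ ℓ) → (∀ i i', s i ≤ 4 * s i') → ∃ A : Set (GaugeConfig 4 (2 * S + 1) SU3), MeasurableSet A ∧ (∀ U : GaugeConfig 4 (2 * S + 1) SU3, ((∃ f : Fin Nf, ∃ μ' : ℝ, reg.mcrit k + reg.a k * m f / reg.Zm k ≤ μ' ∧ ((wilsonCell U μ' 0 s).det = 0 ∨ ∃ c : Fin 4 → Bool, (wilsonCell U μ' (halfCorner s c) (halfSides s c)).det = 0)) ∧ ¬ (∃ ρ : ℕ, ρ₀ ≤ (ρ : ℝ) ∧ ρ ≤ s 0 + s 1 + s 2 + s 3 ∧ ∃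 (x : TorusSite 4 (2 * S + 1)) (r : Fin 4 → ℕ), (∀ i, r i ≤ ρ ∧ ρ ≤ 2 * r i) ∧ (∀ y, siteBox x r y → siteBox 0 s y) ∧ ∃ ψ : {p // wilsonBox x r p} → ℂ, ψ ≠ 0 ∧ ∑ p, ‖((wilsonCell (wilsonFlow ((ρ : ℝ) ^ 2 / 8) U) 0 x r - (wilsonCell (wilsonFlow ((ρ : ℝ) ^ 2 / 8) U) 0 x r)ᴴ) *ᵥ ψ) p‖ ^ 2 ≤ (2 * η₀ / ρ) ^ 2 * ∑ p, ‖ψ p‖ ^ 2)) → U ∈ A) ∧ (∫ U, (if U ∈ A then (1 : ℝ) else 0) * wt U ∂μW) / (∫ U, wt U ∂μW) ≤ η k := by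
  sorry

/-! ## Proved helpers (no `sorry` below this line) -/

/-- **Two-set union bound for a reweighted probability ratio.**  If every point of an event `E` lies in one of
two MEASURABLE sets `A`, `B`, then for a nonnegative integrable weight `w` the ratio
`∫ 1_E w / ∫ w ≤ ∫ 1_A w / ∫ w + ∫ 1_B w / ∫ w` — no measurability of `E` is needed
(`integral_mono_of_nonneg` only asks it of the majorant; a vanishing denominator makes every ratio `0`).
This is the step of the composition where the channel stubs' measurable supersets are consumed. -/
theorem ratio_union_bound {Ω : Type*} [MeasurableSpace Ω] (μ : Measure Ω) (w : Ω → ℝ)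
    (hw0 : ∀ x, 0 ≤ w x) (hwi : Integrable w μ) (E : Ω → Prop) (A B : Set Ω)
    (hA : MeasurableSet A) (hB : MeasurableSet B) (hcov : ∀ x, E x → x ∈ A ∨ x ∈ B) :
    (∫ x, (if E x then (1 : ℝ) else 0) * w x ∂μ) / (∫ x, w x ∂μ) ≤
      (∫ x, (if x ∈ A then (1 : ℝ) else 0) * w x ∂μ) / (∫ x, w x ∂μ) +
        (∫ x, (if x ∈ B then (1 : ℝ) else 0) * w x ∂μ) / (∫ x, w x ∂μ) := by
  have hZ : 0 ≤ ∫ x, w x ∂μ := integral_nonneg hw0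
  have hIA : Integrable (fun x => (if x ∈ A then (1 : ℝ) else 0) * w x) μ := by
    have h := hwi.indicator hA
    refine h.congr (Eventually.of_forall fun x => ?_)
    by_cases hx : x ∈ A <;> simp [hx]
  have hIB : Integrable (fun x => (if x ∈ B then (1 : ℝ) else 0) * w x) μ := by
    have h := hwi.indicator hB
    refine h.congr (Eventually.of_forall fun x => ?_)
    by_cases hx : x ∈ B <;> simp [hx]
  have hle : ∫ x, (if E x then (1 : ℝ) else 0) * w x ∂μ ≤
      ∫ x, ((if x ∈ A then (1 : ℝ) else 0) * w x + (if x ∈ B then (1 : ℝ) else 0) * w x) ∂μ := by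
    refine integral_mono_of_nonneg (Eventually.of_forall fun x => ?_) (hIA.add hIB)
      (Eventually.of_forall fun x => ?_)
    · by_cases hx : E x <;> simp [hx, hw0 x]
    · by_cases hx : E x
      · rcases hcov x hx with h | h
        · by_cases h' : x ∈ B <;> simp [hx, h, h', hw0 x]
        · by_cases h' : x ∈ A <;> simp [hx, h, h', hw0 x]
      · have hA0 : 0 ≤ (if x ∈ A then (1 : ℝ) else 0) * w x := by
          by_cases h' : x ∈ A <;> simp [h', hw0 x]
        have hB0 : 0 ≤ (if x ∈ B then (1 : ℝ) else 0) * w x := by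
          by_cases h' : x ∈ B <;> simp [h', hw0 x]
        simp only [hx, if_false, zero_mul]
        linarith
  rw [integral_add hIA hIB] at hle
  rw [← add_div]
  exact div_le_div_of_nonneg_right hle hZ

/-- The phase-quenched weight `U ↦ ∏_f ‖det D_W(U, m_f, 1)‖` is integrable against the Wilson measure (tree:
`norm_det_diracMatrix`, `integrable_norm_det_diracMatrix`). -/
theorem weight_integrable {Nf : ℕ} (N : ℕ) [NeZero N] (mq : Fin Nf → ℝ) (β : ℝ) :
    Integrable (fun U : GaugeConfig 4 N SU3 =>
        ∏ f, ‖fermionDet (wilsonDirac (fundamentalRep (Fin 3)) U (mq f) 1)‖)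
      (wilsonMeasure (d := 4) (L := N) (fundamentalRep (Fin 3)) β) := by
  have h := integrable_norm_det_diracMatrix (S := N) mq
    (wilsonMeasure (d := 4) (L := N) (fundamentalRep (Fin 3)) β)
  refine h.congr (Eventually.of_forall fun U => ?_)
  exact norm_det_diracMatrix U mq

/-- `2 ^ (Nat.log 2 n + 1) ≤ 2 * (n + 1)` (the dyadic depth of the window against its width). -/
theorem two_pow_log_succ_le (n : ℕ) : (2 : ℝ) ^ (Nat.log 2 n + 1) ≤ 2 * ((n : ℝ) + 1) := by
  have h := Nat.pow_log_le_add_one 2 n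
  have h' : ((2 ^ Nat.log 2 n : ℕ) : ℝ) ≤ ((n + 1 : ℕ) : ℝ) := by exact_mod_cast h
  push_cast at h'
  rw [pow_succ]
  linarith

/-- **Window sum of the seeded-channel law** (where "seeds carry no window entropy" is cashed): for `θ > 0`,
`0 < a ≤ 1`, `ℓ > 0`,  `Σ_{j < J} (2·2^{j+2}·a)^θ ≤ (16(ℓ+1))^θ / (2^θ − 1)` with
`J = Nat.log 2 (⌊ℓ/a⌋₊ / 2) + 1` the crux's dyadic depth at leaf size `b₀ = 2` — geometric in `j`, so the
`≍ log(1/a)` scales of the window sum to a `k`-independent constant. -/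
theorem window_sum_bound (θ a ℓ : ℝ) (hθ : 0 < θ) (ha : 0 < a) (ha1 : a ≤ 1) (hℓ : 0 < ℓ) :
    ∑ j ∈ Finset.range (Nat.log 2 (⌊ℓ / a⌋₊ / 2) + 1), ((2 : ℝ) * 2 ^ (j + 2) * a) ^ θ ≤
      (16 * (ℓ + 1)) ^ θ / ((2 : ℝ) ^ θ - 1) := by
  set n : ℕ := ⌊ℓ / a⌋₊ / 2 with hn
  set J : ℕ := Nat.log 2 n + 1 with hJ
  set x : ℝ := (2 : ℝ) ^ θ with hx
  have hx1 : 1 < x := Real.one_lt_rpow (by norm_num) hθ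
  have hx0 : 0 < x := by linarith
  have hxne : x ≠ 1 := ne_of_gt hx1
  -- each term is `(8a)^θ · x^j`
  have hterm : ∀ j : ℕ, ((2 : ℝ) * 2 ^ (j + 2) * a) ^ θ = (8 * a) ^ θ * x ^ j := by
    intro j
    have h1 : (2 : ℝ) * 2 ^ (j + 2) * a = (8 * a) * (2 : ℝ) ^ j := by ring
    rw [h1, Real.mul_rpow (by positivity) (by positivity)]
    congr 1
    rw [hx, ← Real.rpow_natCast, ← Real.rpow_mul (by norm_num), mul_comm, Real.rpow_mul (by norm_num),
      Real.rpow_natCast]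
  have hsum : ∑ j ∈ Finset.range J, ((2 : ℝ) * 2 ^ (j + 2) * a) ^ θ = (8 * a) ^ θ * ∑ j ∈ Finset.range J, x ^ j := by
    rw [Finset.mul_sum]
    exact Finset.sum_congr rfl fun j _ => hterm j
  rw [hsum, geom_sum_eq hxne J]
  -- `(x^J − 1)/(x − 1) ≤ x^J/(x − 1)` and `x^J = (2^J)^θ`
  have hxJ : x ^ J = ((2 : ℝ) ^ J) ^ θ := by
    rw [hx, ← Real.rpow_natCast, ← Real.rpow_mul (by norm_num), mul_comm, Real.rpow_mul (by norm_num),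
      Real.rpow_natCast]
  have hgeom : (x ^ J - 1) / (x - 1) ≤ ((2 : ℝ) ^ J) ^ θ / (x - 1) := by
    rw [← hxJ]
    exact div_le_div_of_nonneg_right (by linarith) (by linarith)
  have h8a : 0 ≤ (8 * a) ^ θ := by positivity
  calc (8 * a) ^ θ * ((x ^ J - 1) / (x - 1))
      ≤ (8 * a) ^ θ * (((2 : ℝ) ^ J) ^ θ / (x - 1)) := mul_le_mul_of_nonneg_left hgeom h8a
    _ = ((8 * a) * (2 : ℝ) ^ J) ^ θ / (x - 1) := by
        rw [Real.mul_rpow (show (0 : ℝ) ≤ 8 * a by positivity) (show (0 : ℝ) ≤ (2 : ℝ) ^ J by positivity)]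
        ring
    _ ≤ (16 * (ℓ + 1)) ^ θ / (x - 1) := by
        refine div_le_div_of_nonneg_right ?_ (by linarith)
        refine Real.rpow_le_rpow (by positivity) ?_ hθ.le
        -- `8a · 2^J ≤ 16 a (n+1) ≤ 16(ℓ + 1)`
        have hJle : (2 : ℝ) ^ J ≤ 2 * ((n : ℝ) + 1) := two_pow_log_succ_le n
        have hnle : (n : ℝ) ≤ ℓ / a := by
          have h1 : (n : ℝ) ≤ (⌊ℓ / a⌋₊ : ℝ) := by
            rw [hn]; exact_mod_cast Nat.div_le_self _ _
          exact h1.trans (Nat.floor_le (by positivity))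
        have hna : a * (n : ℝ) ≤ ℓ := by
          rw [le_div_iff₀ ha] at hnle; linarith
        nlinarith

/-- **Check against the landed negative lemma `Negative/CellPositivity`** (imported): at a POSITIVE valence
mass the CROSSING event of the channel stubs is EMPTY — every Dirichlet cell determinant is positive there
(`cellDetRe_pos`), so no stub asks for (or could be refuted by) a crossing above a positive mass; for such masses
T and N hold with the empty measurable superset. -/
theorem crossing_empty_of_pos {N : ℕ} [NeZero N] (U : GaugeConfig 4 N SU3) (s : Fin 4 → ℕ) {μ : ℝ}
    (hμ : 0 < μ) :
    ¬ (∃ μ' : ℝ, μ ≤ μ' ∧ ((wilsonCell U μ' 0 s).det = 0 ∨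
      ∃ c : Fin 4 → Bool, (wilsonCell U μ' (halfCorner s c) (halfSides s c)).det = 0)) := by
  rintro ⟨μ', hμ', h⟩
  have hμ'pos : 0 < μ' := lt_of_lt_of_le hμ hμ'
  rcases h with h | ⟨c, h⟩
  · have hp := Summit.QuantumFields.QCD.Theorems.NegativeCellsDiluteCellPositivity.cellDetRe_pos U hμ'pos 0 s
    rw [cellDetRe_eq, h] at hp
    simp at hp
  · have hp := Summit.QuantumFields.QCD.Theorems.NegativeCellsDiluteCellPositivity.cellDetRe_pos U hμ'pos
      (halfCorner s c) (halfSides s c)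
    rw [cellDetRe_eq, h] at hp
    simp at hp

/-! ## The composition: the five stubs (+ the route support `SignDefectForcesCrossing`) imply the crux BY NAME -/

set_option maxHeartbeats 1600000 in
/-- **Skeleton theorem.**  `NegativeCellsDilute` follows from the five registered stubs and the route's
provable-now support `SignDefectForcesCrossing` (a registered obligation, taken as a named hypothesis).
Witnesses: `reg`, `M₀` and the located line from `stub_sharpCriticalLine`; `M₀^crux = max(M₀', M₁ᵀ, M₁ᴺ)`,
`b₀ = 2`, `ℓ = min(ℓᵀ, ℓᴺ, 1)`; for `m > M₀^crux`, `R = max(R_pin, R_T, R_N)`; clause (b) verbatim from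
`stub_parityPinOnLine`; clause (a) with `δ_j(k) = C (2·2^{j+2} a_k)^θ η_T(k) + η_N(k)`: the per-box bound is
`SignDefectForcesCrossing` + the seed/no-seed dichotomy + `ratio_union_bound` + the two channel stubs, and
`Σ_{j<J} δ_j ≤ ε` eventually by `window_sum_bound` (`η_T → 0`) and `J ≤ ℓ/a_k + 1`, `η_N/a_k → 0`. -/
theorem NegativeCellsDilute_of (hSD : SignDefectForcesCrossing) : NegativeCellsDilute := by
  have hC := stub_sharpCriticalLine
  have hB := stub_parityPinOnLine
  have hS := stub_seedActionFloor
  have hT := stub_seededChannel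
  have hN := stub_seedlessChannel
  intro Nf hNf
  obtain ⟨reg, hms, haf, hmc, M₀, hM₀, hloc⟩ := hC Nf hNf
  obtain ⟨A₀, hA₀, η₀, hη₀, ρ₀, hρ₀, hfloor⟩ := hS
  obtain ⟨M₀', hM₀', hpin⟩ := hB Nf hNf reg hms haf M₀ hM₀ hloc
  obtain ⟨M₁, ℓ₁, hℓ₁, C, hC0, θ, hθ, ηT, hηT0, hηT, HT⟩ :=
    hT A₀ η₀ ρ₀ hA₀ hη₀ hρ₀ hfloor Nf hNf reg hms haf hmc M₀ hM₀ (fun m hm => (hloc m hm).1)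
  obtain ⟨M₂, ℓ₂, hℓ₂, ηN, hηN0, hηN, HN⟩ :=
    hN η₀ ρ₀ hη₀ hρ₀ Nf hNf reg hms haf hmc M₀ hM₀ (fun m hm => (hloc m hm).1)
  -- witnesses of the crux
  obtain ⟨ℓ, hℓdef⟩ : ∃ ℓ : ℝ, ℓ = min (min ℓ₁ ℓ₂) 1 := ⟨_, rfl⟩
  have hℓpos : 0 < ℓ := by rw [hℓdef]; exact lt_min (lt_min hℓ₁ hℓ₂) one_pos
  have hℓ1 : ℓ ≤ ℓ₁ := by rw [hℓdef]; exact (min_le_left _ _).trans (min_le_left _ _)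
  have hℓ2 : ℓ ≤ ℓ₂ := by rw [hℓdef]; exact (min_le_left _ _).trans (min_le_right _ _)
  have hℓone : ℓ ≤ 1 := by rw [hℓdef]; exact min_le_right _ _
  refine ⟨reg, hms, haf, max M₀' (max M₁ M₂), hM₀.trans (hM₀'.trans (le_max_left M₀' (max M₁ M₂))),
    2, le_rfl, ℓ, hℓpos, ?_⟩
  intro m hm
  have hm0 : ∀ f, M₀' < m f := fun f => lt_of_le_of_lt (le_max_left M₀' (max M₁ M₂)) (hm f)
  have hm1 : ∀ f, M₁ < m f := fun f =>
    lt_of_le_of_lt ((le_max_left M₁ M₂).trans (le_max_right M₀' (max M₁ M₂))) (hm f)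
  have hm2 : ∀ f, M₂ < m f := fun f =>
    lt_of_le_of_lt ((le_max_right M₁ M₂).trans (le_max_right M₀' (max M₁ M₂))) (hm f)
  obtain ⟨Rb, hRb, hb⟩ := hpin m hm0
  obtain ⟨RT, hRT, hTm⟩ := HT m hm1
  obtain ⟨RN, hRN, hNm⟩ := HN m hm2
  refine ⟨max Rb (max RT RN), lt_of_lt_of_le hRb (le_max_left _ _), ?_, ?_⟩
  swap
  · -- clause (b): verbatim from the parity stub
    intro M hM
    have hM' : M₀' < M := lt_of_le_of_lt (le_max_left M₀' (max M₁ M₂)) hM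
    filter_upwards [hb M hM'] with k hk S hS
    exact hk S ((le_max_left _ _).trans hS)
  -- clause (a)
  intro ε hε
  -- smallness of the two null sequences and of `a_k`, eventually in `k`
  have hKpos : 0 < (16 * (ℓ + 1)) ^ θ / ((2 : ℝ) ^ θ - 1) := by
    have hx1 : 1 < (2 : ℝ) ^ θ := Real.one_lt_rpow (by norm_num) hθ
    exact div_pos (by positivity) (by linarith)
  set K : ℝ := (16 * (ℓ + 1)) ^ θ / ((2 : ℝ) ^ θ - 1) with hK
  have h2CK : 0 < 2 * (C + 1) * K := mul_pos (mul_pos two_pos (by linarith)) hKpos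
  have hε1 : 0 < ε / (2 * (C + 1) * K) := div_pos hε h2CK
  have hε2 : 0 < ε / (2 * (ℓ + 1)) := div_pos hε (by linarith)
  have evT : ∀ᶠ k : ℕ in atTop, ηT k < ε / (2 * (C + 1) * K) := hηT.eventually (gt_mem_nhds hε1)
  have evN : ∀ᶠ k : ℕ in atTop, ηN k / reg.a k < ε / (2 * (ℓ + 1)) := by
    have h1 := hηN 1
    simp only [pow_one] at h1
    exact h1.eventually (gt_mem_nhds hε2)
  have eva : ∀ᶠ k : ℕ in atTop, reg.a k < 1 := reg.tendsto_a.eventually (gt_mem_nhds one_pos)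
  filter_upwards [hTm, hNm, evT, evN, eva] with k hkT hkN hkηT hkηN hka S hS
  have hST : RT ≤ reg.a k * (2 * S + 1) := ((le_max_left _ _).trans (le_max_right _ _)).trans hS
  have hSN : RN ≤ reg.a k * (2 * S + 1) := ((le_max_right _ _).trans (le_max_right _ _)).trans hS
  have hak : 0 < reg.a k := reg.a_pos k
  dsimp only
  refine ⟨fun j => C * ((2 : ℝ) * 2 ^ (j + 2) * reg.a k) ^ θ * ηT k + ηN k, ?_, ?_⟩
  · -- the window sum
    beta_reduce
    rw [Finset.sum_add_distrib, Finset.sum_const, Finset.card_range, nsmul_eq_mul]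
    have hsumT : ∑ j ∈ Finset.range (Nat.log 2 (⌊ℓ / reg.a k⌋₊ / 2) + 1),
        C * ((2 : ℝ) * 2 ^ (j + 2) * reg.a k) ^ θ * ηT k ≤ ε / 2 := by
      have hfac : ∑ j ∈ Finset.range (Nat.log 2 (⌊ℓ / reg.a k⌋₊ / 2) + 1),
          C * ((2 : ℝ) * 2 ^ (j + 2) * reg.a k) ^ θ * ηT k =
          (C * ηT k) * ∑ j ∈ Finset.range (Nat.log 2 (⌊ℓ / reg.a k⌋₊ / 2) + 1),
            ((2 : ℝ) * 2 ^ (j + 2) * reg.a k) ^ θ := by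
        rw [Finset.mul_sum]
        exact Finset.sum_congr rfl fun j _ => by ring
      rw [hfac]
      have hW := window_sum_bound θ (reg.a k) ℓ hθ hak hka.le hℓpos
      have hCη : 0 ≤ C * ηT k := mul_nonneg hC0 (hηT0 k)
      calc C * ηT k * ∑ j ∈ Finset.range (Nat.log 2 (⌊ℓ / reg.a k⌋₊ / 2) + 1),
            ((2 : ℝ) * 2 ^ (j + 2) * reg.a k) ^ θ
          ≤ C * ηT k * K := mul_le_mul_of_nonneg_left hW hCη
        _ ≤ (C + 1) * (ε / (2 * (C + 1) * K)) * K := by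
            have h1 : C * ηT k ≤ (C + 1) * ηT k := by nlinarith [hηT0 k]
            have h2 : (C + 1) * ηT k ≤ (C + 1) * (ε / (2 * (C + 1) * K)) :=
              mul_le_mul_of_nonneg_left hkηT.le (by linarith)
            nlinarith [hKpos]
        _ = ε / 2 := by field_simp
    have hsumN : ((Nat.log 2 (⌊ℓ / reg.a k⌋₊ / 2) + 1 : ℕ) : ℝ) * ηN k ≤ ε / 2 := by
      have hJ : ((Nat.log 2 (⌊ℓ / reg.a k⌋₊ / 2) + 1 : ℕ) : ℝ) ≤ ℓ / reg.a k + 1 := by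
        have h1 : Nat.log 2 (⌊ℓ / reg.a k⌋₊ / 2) ≤ ⌊ℓ / reg.a k⌋₊ :=
          (Nat.log_le_self _ _).trans (Nat.div_le_self _ _)
        have h2 : ((Nat.log 2 (⌊ℓ / reg.a k⌋₊ / 2) : ℕ) : ℝ) ≤ (⌊ℓ / reg.a k⌋₊ : ℝ) := by exact_mod_cast h1
        have h3 : (⌊ℓ / reg.a k⌋₊ : ℝ) ≤ ℓ / reg.a k := Nat.floor_le (by positivity)
        push_cast
        linarith
      have hη : ηN k ≤ reg.a k * (ε / (2 * (ℓ + 1))) := by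
        have := hkηN.le
        rwa [div_le_iff₀ hak, mul_comm] at this
      calc ((Nat.log 2 (⌊ℓ / reg.a k⌋₊ / 2) + 1 : ℕ) : ℝ) * ηN k
          ≤ (ℓ / reg.a k + 1) * (reg.a k * (ε / (2 * (ℓ + 1)))) :=
            mul_le_mul hJ hη (hηN0 k) (by positivity)
        _ = (ℓ + reg.a k) * (ε / (2 * (ℓ + 1))) := by field_simp
        _ ≤ (ℓ + 1) * (ε / (2 * (ℓ + 1))) := by
            refine mul_le_mul_of_nonneg_right (by linarith) hε2.le
        _ = ε / 2 := by field_simp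
    linarith
  · -- the per-box bound
    intro j hj s hs
    beta_reduce
    have hs2 : ∀ i, 2 ≤ s i ∧ s i ≤ 2 * S + 1 ∧ (s i : ℝ) * reg.a k ≤ ℓ₁ := fun i =>
      ⟨le_trans (by calc (2 : ℕ) = 2 * 2 ^ 0 := by norm_num
                          _ ≤ 2 * 2 ^ j := Nat.mul_le_mul_left 2 (Nat.one_le_two_pow)) (hs i).1,
        (hs i).2.2.1, (hs i).2.2.2.trans hℓ1⟩
    have hs2' : ∀ i, 2 ≤ s i ∧ s i ≤ 2 * S + 1 ∧ (s i : ℝ) * reg.a k ≤ ℓ₂ := fun i =>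
      ⟨(hs2 i).1, (hs i).2.2.1, (hs i).2.2.2.trans hℓ2⟩
    have hcub : ∀ i i', s i ≤ 4 * s i' := fun i i' => by
      have h1 := (hs i).2.1
      have h2 := (hs i').1
      calc s i ≤ 2 * 2 ^ (j + 2) := h1.le
        _ = 4 * (2 * 2 ^ j) := by ring
        _ ≤ 4 * s i' := Nat.mul_le_mul_left 4 h2
    obtain ⟨A, hAm, hAsub, hPA⟩ := hkT S hST s hs2 hcub
    obtain ⟨B, hBm, hBsub, hPB⟩ := hkN S hSN s hs2' hcub
    -- cover: a sign defect forces a crossing above the valence mass; then seed or no seed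
    have hcov : ∀ U : GaugeConfig 4 (2 * S + 1) SU3,
        (∃ f, IsSignDefect U (reg.mcrit k + reg.a k * m f / reg.Zm k) j s) → U ∈ A ∨ U ∈ B := by
      intro U hU
      obtain ⟨f, hf⟩ := hU
      obtain ⟨μ', hμ', hcross⟩ := hSD (2 * S + 1) U _ j s hf
      have hCross : ∃ f : Fin Nf, ∃ μ' : ℝ, reg.mcrit k + reg.a k * m f / reg.Zm k ≤ μ' ∧ ((wilsonCell U μ' 0 s).det = 0 ∨ ∃ c : Fin 4 → Bool, (wilsonCell U μ' (halfCorner s c) (halfSides s c)).det = 0) :=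
        ⟨f, μ', hμ', hcross⟩
      by_cases hseed : ∃ ρ : ℕ, ρ₀ ≤ (ρ : ℝ) ∧ ρ ≤ s 0 + s 1 + s 2 + s 3 ∧ ∃ (x : TorusSite 4 (2 * S + 1)) (r : Fin 4 → ℕ), (∀ i, r i ≤ ρ ∧ ρ ≤ 2 * r i) ∧ (∀ y, siteBox x r y → siteBox 0 s y) ∧ ∃ ψ : {p // wilsonBox x r p} → ℂ, ψ ≠ 0 ∧ ∑ p, ‖((wilsonCell (wilsonFlow ((ρ : ℝ) ^ 2 / 8) U) 0 x r - (wilsonCell (wilsonFlow ((ρ : ℝ) ^ 2 / 8) U) 0 x r)ᴴ) *ᵥ ψ) p‖ ^ 2 ≤ (2 * η₀ / ρ) ^ 2 * ∑ p, ‖ψ p‖ ^ 2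
      · exact Or.inl (hAsub U ⟨hCross, hseed⟩)
      · exact Or.inr (hBsub U ⟨hCross, hseed⟩)
    have hw0 : ∀ U : GaugeConfig 4 (2 * S + 1) SU3,
        0 ≤ ∏ f, ‖fermionDet (wilsonDirac (fundamentalRep (Fin 3)) U
          (reg.mcrit k + reg.a k * m f / reg.Zm k) 1)‖ :=
      fun U => Finset.prod_nonneg fun f _ => norm_nonneg _
    have hwi := weight_integrable (2 * S + 1) (fun f => reg.mcrit k + reg.a k * m f / reg.Zm k) (reg.β k)
    have hU := ratio_union_bound _ _ hw0 hwi _ A B hAm hBm hcov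
    refine hU.trans (add_le_add (hPA.trans ?_) hPB)
    -- `C (s₀ a_k)^θ η_T ≤ C (2·2^{j+2} a_k)^θ η_T`
    have hs0 : ((s 0 : ℕ) : ℝ) * reg.a k ≤ (2 : ℝ) * 2 ^ (j + 2) * reg.a k := by
      have h1 : ((s 0 : ℕ) : ℝ) ≤ (2 : ℝ) * 2 ^ (j + 2) := by
        have := (hs 0).2.1.le
        exact_mod_cast this
      exact mul_le_mul_of_nonneg_right h1 hak.le
    have hr : (((s 0 : ℕ) : ℝ) * reg.a k) ^ θ ≤ ((2 : ℝ) * 2 ^ (j + 2) * reg.a k) ^ θ :=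
      Real.rpow_le_rpow (by positivity) hs0 hθ.le
    exact mul_le_mul_of_nonneg_right (mul_le_mul_of_nonneg_left hr hC0) (hηT0 k)

/-- **Check against the landed negative lemma `Negative/PinWindow`** (imported): the composed crux inherits the
pin window — any located line delivered by the stubs has its probes `mcrit k − a_k M/Z_m k ≤ 0` eventually
(consistent with `Tendsto reg.mcrit atTop (𝓝 0)` in `stub_sharpCriticalLine`). -/
theorem pinWindow_of_line (hSD : SignDefectForcesCrossing) :
    ∀ Nf : ℕ, (Nf = 2 ∨ Nf = 3) → ∃ reg : QCDRegularisation Nf, reg.HasMassScaling ∧ ∃ M₀ : ℝ,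
      0 ≤ M₀ ∧ ∀ m : Fin Nf → ℝ, (∀ f, M₀ < m f) → ∀ M : ℝ, M₀ < M → ∀ᶠ k : ℕ in Filter.atTop,
        reg.mcrit k - reg.a k * M / reg.Zm k ≤ 0 :=
  Summit.QuantumFields.QCD.Theorems.NegativeCellsDilutePinWindow.pin_window_of_crux (NegativeCellsDilute_of hSD)

/-- **Unconditional composition (lead c1, 2026-08-16).** The named hypothesis `SignDefectForcesCrossing` of
`NegativeCellsDilute_of` is a LANDED route support (`signDefectForcesCrossing_proof`, tree), so the five registered
stubs alone imply the crux by name. -/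
theorem NegativeCellsDilute_of_stubs : NegativeCellsDilute :=
  NegativeCellsDilute_of Summit.QuantumFields.QCD.Theorems.signDefectForcesCrossing_proof

end Summit.QuantumFields.QCD.Cruxes.NegativeCellsDilute.PriceTheSeedNotTheSpot

end
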